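import Literature.Analysis.FluidPDE.NormalisedPressurePV
import HarnessLib

/-!
# Additivity of the normalised pressure over disjointly supported fields

Analysis/FluidPDE support file (serves the decomposition of the barrier fact
`Literature.Barriers.NavierStokesRegularity.NSIBlockExists`, Scheffer 1985 / Ożański 2017: the
field of Proposition 9 there is a sum `u = u[a₁v₁,q₁] + u[a₂v₂,q₂]` of two axisymmetric fields
with disjoint supports `R(Ū₁)`, `R(Ū₂)`, and its pressure function is computed as the sum of the
two pressure functions — Ożański 2017, Lemma 4 (iii): "if `f, f̃` have disjoint supports then
`p[v + ṽ, f + f̃] = p[v,f] + p[ṽ,f̃]`", which "follows directly from the definition").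

The normalised pressure `p̃[u] = -Δ⁻¹∂ᵢ∂ⱼ(uᵢuⱼ)` (accepted `NormalisedPressure.lean`,
`p̃[u](x) = -|u(x)|²/d + p.v.∫ K(x-y)(u y) dy`) is QUADRATIC, not linear, in `u`; but the tensor
`u ⊗ u`, hence the integrand `K(x-y)(u y)`, is additive over fields with pointwise disjoint
supports (`u₁(y) = 0 ∨ u₂(y) = 0` for every `y`). We prove, in any dimension:

* `pressureKernel_add_of_eq_zero_or` — `K(z)(a + b) = K(z)(a) + K(z)(b)` if `a = 0 ∨ b = 0`;
* `truncatedPressureIntegral_add_of_disjoint`, `HasPressurePV.add_of_disjoint` — truncated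
  integrals and principal values add (given integrability / principal values of the summands);
* `normalisedPressure_add_of_disjoint` — **`p̃[u₁ + u₂](x) = p̃[u₁](x) + p̃[u₂](x)`** at every point
  where both summands have a principal value; and on `ℝ³`, unconditionally for `C¹` finite-energy
  summands (`normalisedPressure_add_of_disjoint_of_contDiff`, by the accepted
  `hasPressurePV_of_contDiff_holds`).

## References

* W. S. Ożański, *On weak solutions to the Navier–Stokes inequality with internal
  singularities*, arXiv:1709.00602 (2017), Lemma 4 (iii) and §4.2 (the pressure of
  `u[a₁v₁,q₁] + u[a₂v₂,q₂]`). [`Ozanski2017NSISingular`]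
-/

noncomputable section

open MeasureTheory Set Filter Metric Topology

namespace Literature.Analysis.FluidPDE

variable {E : Type*} [NormedAddCommGroup E] [InnerProductSpace ℝ E] [FiniteDimensional ℝ E]
  [MeasurableSpace E] [BorelSpace E]

open scoped RealInnerProductSpace ENNReal

section Disjoint

variable {u₁ u₂ : E → E}

/-- The (quadratic) pressure kernel is additive in the velocity slot over vectors one of which
vanishes. [folklore] -/
theorem pressureKernel_add_of_eq_zero_or (z : E) {a b : E} (h : a = 0 ∨ b = 0) :
    pressureKernel z (a + b) = pressureKernel z a + pressureKernel z b := by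
  rcases h with rfl | rfl <;> simp

/-- For pointwise disjointly supported fields the truncated integrands add. [folklore] -/
theorem pressureKernel_sub_add_apply (h : ∀ y, u₁ y = 0 ∨ u₂ y = 0) (x y : E) :
    pressureKernel (x - y) ((u₁ + u₂) y) =
      pressureKernel (x - y) (u₁ y) + pressureKernel (x - y) (u₂ y) :=
  pressureKernel_add_of_eq_zero_or _ (h y)

/-- **Truncated integrals add** over disjointly supported fields (given integrability of the two
truncated integrands). [cite: Ozanski2017NSISingular, Lemma 4 (iii)] -/
theorem truncatedPressureIntegral_add_of_disjoint (h : ∀ y, u₁ y = 0 ∨ u₂ y = 0) {x : E} {ε : ℝ}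
    (h₁ : IntegrableOn (fun y => pressureKernel (x - y) (u₁ y)) (closedBall x ε)ᶜ)
    (h₂ : IntegrableOn (fun y => pressureKernel (x - y) (u₂ y)) (closedBall x ε)ᶜ) :
    truncatedPressureIntegral (u₁ + u₂) x ε =
      truncatedPressureIntegral u₁ x ε + truncatedPressureIntegral u₂ x ε := by
  simp only [truncatedPressureIntegral, pressureKernel_sub_add_apply h]
  exact integral_add h₁ h₂

/-- **Principal values add** over disjointly supported fields. [cite: Ozanski2017NSISingular, Lemma 4 (iii)] -/
theorem HasPressurePV.add_of_disjoint (h : ∀ y, u₁ y = 0 ∨ u₂ y = 0) {x : E} {L₁ L₂ : ℝ}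
    (h₁ : HasPressurePV u₁ x L₁) (h₂ : HasPressurePV u₂ x L₂) :
    HasPressurePV (u₁ + u₂) x (L₁ + L₂) := by
  have hI := h₁.1.and h₂.1
  refine ⟨hI.mono fun ε hε => ?_, ?_⟩
  · have heq : (fun y => pressureKernel (x - y) ((u₁ + u₂) y)) =
        fun y => pressureKernel (x - y) (u₁ y) + pressureKernel (x - y) (u₂ y) :=
      funext (pressureKernel_sub_add_apply h x)
    rw [IntegrableOn, heq]
    exact hε.1.add hε.2
  · have heq : truncatedPressureIntegral (u₁ + u₂) x =ᶠ[𝓝[>] 0]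
        fun ε => truncatedPressureIntegral u₁ x ε + truncatedPressureIntegral u₂ x ε :=
      hI.mono fun ε hε => truncatedPressureIntegral_add_of_disjoint h hε.1 hε.2
    exact (h₁.2.add h₂.2).congr' heq.symm

/-- **`p̃[u₁ + u₂] = p̃[u₁] + p̃[u₂]`** at every point where both disjointly supported summands have
a principal value (Ożański 2017, Lemma 4 (iii): the pressure function of a disjointly supported
sum is the sum of the pressure functions). [cite: Ozanski2017NSISingular, Lemma 4 (iii)] -/
theorem normalisedPressure_add_of_disjoint (h : ∀ y, u₁ y = 0 ∨ u₂ y = 0) {x : E}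
    (h₁ : ∃ L₁, HasPressurePV u₁ x L₁) (h₂ : ∃ L₂, HasPressurePV u₂ x L₂) :
    normalisedPressure (u₁ + u₂) x = normalisedPressure u₁ x + normalisedPressure u₂ x := by
  obtain ⟨L₁, hL₁⟩ := h₁
  obtain ⟨L₂, hL₂⟩ := h₂
  rw [normalisedPressure_eq hL₁, normalisedPressure_eq hL₂,
    normalisedPressure_eq (hL₁.add_of_disjoint h hL₂)]
  have hx : ‖(u₁ + u₂) x‖ ^ 2 = ‖u₁ x‖ ^ 2 + ‖u₂ x‖ ^ 2 := by
    rcases h x with h0 | h0 <;> simp [h0]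
  rw [hx]
  ring

end Disjoint

/-! ### On `ℝ³`: unconditional additivity for `C¹` finite-energy summands -/

section R3

/-- **The pressure function of a disjointly supported sum of `C¹` finite-energy fields on `ℝ³` is
the sum of the pressure functions** (Ożański 2017, Lemma 4 (iii), as used in §4.2:
`p(t) = p*[a₁ᵏ(t)v₁, q₁ᵏ_t] + p*[a₂ᵏ(t)v₂, q₂ᵏ_t]`); both principal values exist everywhere by
the accepted `hasPressurePV_of_contDiff_holds`. [cite: Ozanski2017NSISingular, Lemma 4 (iii)] -/
theorem normalisedPressure_add_of_disjoint_of_contDiff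
    {u₁ u₂ : EuclideanSpace ℝ (Fin 3) → EuclideanSpace ℝ (Fin 3)}
    (h : ∀ y, u₁ y = 0 ∨ u₂ y = 0) (hu₁ : ContDiff ℝ 1 u₁) (hE₁ : (∫⁻ x, ‖u₁ x‖ₑ ^ 2) < ⊤)
    (hu₂ : ContDiff ℝ 1 u₂) (hE₂ : (∫⁻ x, ‖u₂ x‖ₑ ^ 2) < ⊤) :
    normalisedPressure (u₁ + u₂) = normalisedPressure u₁ + normalisedPressure u₂ :=
  funext fun x => normalisedPressure_add_of_disjoint h
    (hasPressurePV_of_contDiff_holds u₁ hu₁ hE₁ x) (hasPressurePV_of_contDiff_holds u₂ hu₂ hE₂ x)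

end R3

end Literature.Analysis.FluidPDE

end
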